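/-
Copyright (c) 2026 the pub-hodgecm-mathlib formalisation cell (harness21).  Prover seat hodgecm-mathlib-F0P3a-p07 (g12), 2026-09-01.  Road «S3-ram» seeding wave (LEAD T11-41; owner F0P3a-p06 (g15)):
organ «(δ) tame-ram twin», FILE 2 of 2 — the Levi H-values at a TAME-RAMIFIED non-split place.
-/
import Literature.NumberTheory.Rogawski1990.DepthZeroTransferHValuesLevi      -- ★ p846606 (this seat): (δ) §1 `torus_mem_cmLocalIntegralLevel_of_deep`, `redMat_map_torus_eq_one_of_deep`, `indicator_ite_redMat_conj_torus_mul_eq` (place-generic) + ★ H-descent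
import Literature.NumberTheory.Automorphic.LineStrataMeasureRamified           -- ★ FILE 1-ram (this seat): `measureReal_lineStratum_zero∕one_of_ramified`
import HarnessLib

/-!
# T3′'s H-side values near the identity, LEVI population, at a TAME-RAMIFIED non-split place: `Φ_H(⟦(t, u)⟧, χ₀) = ν_H(K_H)·J_H(t)` and `Φ_H(⟦(t, u)⟧, χ₁) = 0`

Topic `NumberTheory/Rogawski1990`; namespace `Literature.NumberTheory.Automorphic.UnitaryGroup`.  THEOREMS ONLY (no definition, no instance, no notation, no named fact, no `sorry`).
Cell `pub/hodgecm-mathlib`, crux H413 = `stmt-HodgeConjecture-24833`; road «S3-ram» seeding wave (LEAD F0P3a-plan (g12) T11-41; owner∕table F0P3a-p06 (g15)), organ **«(δ) TAME-RAM TWIN», FILE 2**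
(seat F0P3a-p07 (g12)); the ramified twin of ★ `DepthZeroTransferHValuesLevi` (p846606).  HONEST LABEL: HC_CM is proved only modulo the cell's 2 remaining named inputs (hLiu418 24832, h413 24833)
until rung 0 closes; «S3-ram» is Literature seeding with no books consequence; this file is unconditional and discharges nothing by itself.

THE MATHEMATICS ([Rogawski1990] §4.9 p. 55, Prop. 4.9.1 (b); §4.3 (4.3.1) p. 43).  Same frame as ★ (δ): `H_v = U(Φ₂)(L⁺_v) × U(Φ₁)(L⁺_v)`, `K_H = K₂ × K₁`, `t = diag(d₀, d₁)` REGULAR and DEEP,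
`u ∈ U(Φ₁)(L⁺_v)`, `m_H` canonical, `ν_H` any right-invariant Haar; but `w` is now TAME-RAMIFIED (`e(w|v) ≠ 1`, `|2|_w = 1`).  The ★ H-descent and the ★ (δ) integrand collapse are
place-generic (they bind `hw` only); the one inert input of (δ), the line-strata ratio `(1, q − 1)∕q`, is replaced by ★ FILE 1-ram: at a ramified place the integral skew line lies in `𝔪_w`,
so the rank-`1` stratum of `N₂ ∩ K₂` is EMPTY and the rank-`0` stratum is everything.  Hence **`Φ_H(⟦(t,u)⟧, χ₀) = ν_H(K_H)·J_H(t)`** (`κ₂(K₂)`, `μ(N₂ ∩ K₂)` cancel) and **`Φ_H(⟦(t,u)⟧, χ₁) = 0`**,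
`J_H(t) = χ⁻(d₀⁻¹d₁ − 1)⁻¹` the ★ H-descent token (at a ramified `w`: `= q^{m}` with `ord_w(d₀⁻¹d₁ − 1) = 2m`).
* HEADS **`classOrbitalIntegral_chiZero_eq_of_torus_deep_ramified`**, **`classOrbitalIntegral_chiOne_eq_zero_of_torus_deep_ramified`** — binders = ★ (δ) heads' VERBATIM with `hv ↦ (he) (h2w)`.

## References
* [Rogawski1990] J. D. Rogawski, *Automorphic Representations of Unitary Groups in Three Variables*, Ann. of Math. Stud. 123 (1990), §1.10 p. 9; §4.3 (4.3.1) p. 43; §4.9 p. 54–55, Prop. 4.9.1 (b).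
* [Serre1979] J.-P. Serre, *Local Fields*, GTM 67 (1979), Ch. I §7–§8.
* [Kottwitz1986] R. E. Kottwitz, *Base change for unit elements of Hecke algebras*, Compositio Math. 60 (1986), §3.
-/

set_option autoImplicit false

noncomputable section

open MeasureTheory Measure Set Filter Topology NumberField IsDedekindDomain Matrix ValuativeRel
open scoped ENNReal NNReal ValuativeRel Matrix MatrixGroups

namespace Literature.NumberTheory.Automorphic.UnitaryGroup

open Literature.NumberTheory.Rogawski1990 Literature.NumberTheory.Automorphic Literature.NumberTheory.Automorphic.IntegralReduction
open Literature.NumberTheory.Automorphic.UnitaryGroup.HeisRing Literature.NumberTheory.Automorphic.UnitaryGroup.LineRing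

variable (L : Type) [Field L] [NumberField L] [IsCMField L] (v : HeightOneSpectrum (𝓞 ↥(maximalRealSubfield L)))
  (w : PlacesOver L v) (hw : IsCMField.complexConj L • w.1 = w.1)

/-! ## The canonical orbital integrals `Φ_H(⟦(t, u)⟧, χ₀) = ν_H(K_H)·J_H(t)`, `Φ_H(⟦(t, u)⟧, χ₁) = 0` at a deep regular diagonal class, TAME-RAMIFIED place -/

set_option maxHeartbeats 3200000 in
set_option synthInstance.maxHeartbeats 400000 in
-- instance-term unification on the CM local carriers (two spellings of `U(Φ₂)(L⁺_v)`), as in ★ `UnitaryGroupTorusOrbitalIntegralCanonicalH`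
include hw in
/-- **(δ)-RAM HEAD (χ₀): `Φ_H(⟦(t, u)⟧, χ₀) = ν_H(K₂ × K₁) · J_H(t)`** at a TAME-RAMIFIED non-split `w` (`e ≠ 1`, `|2|_w = 1`) for HEAD v4's `χ₀ = 1_{K_H}·[(red h_{W,w} − 1)² = 0 ∧ rank(red h_{W,w} − 1) = 0]`, at the class of
`(t, u)`, `t = diag(d₀, d₁) ∈ T₂(L⁺_v)` REGULAR (`d₀⁻¹d₁ − 1` a unit) and DEEP (`dᵢ ≡ 1 (mod 𝔪_w)`), `u ∈ U(Φ₁)(L⁺_v) = K₁`; `m_H` CANONICAL for `(P_H, ν_H)` (`ν_H` ANY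
right-invariant Haar measure), `J_H(t) = χ⁻(d₀⁻¹d₁ − 1)⁻¹` the ★ H-descent token.  Proof: ★ H-descent `classOrbitalIntegral_prod_eq_smul_integral_prod_of_torus_regular_of_nonsplit`
with `φ = χ₀`, the integrand collapse (§1), `∫_{K₂ × N₂} 1_{S₀}(n) = κ₂(K₂)·μ(S₀)`, the ramified line stratum `μ(S₀) = μ(N₂ ∩ K₂)` (★ `LineStrataMeasureRamified`); `κ₂(K₂)`, `μ(N₂ ∩ K₂)` cancel.
Decidability binder `χdec` (any instance: pass `_`). [cite: Rogawski1990, §4.9 Prop. 4.9.1 (b) p. 55; §4.3 (4.3.1) p. 43] [cite: Flicker1998UnitaryFL, §2] -/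
theorem classOrbitalIntegral_chiZero_eq_of_torus_deep_ramified
    [MeasurableSpace ((cmDatum L 2 (Matrix.of fun i j : Fin 2 => if i.val + j.val + 1 = 2 then (1 : L) else 0)).Local v × (cmDatum L 1 (Matrix.of fun i j : Fin 1 => if i.val + j.val + 1 = 1 then (1 : L) else 0)).Local v)] [BorelSpace ((cmDatum L 2 (Matrix.of fun i j : Fin 2 => if i.val + j.val + 1 = 2 then (1 : L) else 0)).Local v × (cmDatum L 1 (Matrix.of fun i j : Fin 1 => if i.val + j.val + 1 = 1 then (1 : L) else 0)).Local v)]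
    [∀ a : ((cmDatum L 2 (Matrix.of fun i j : Fin 2 => if i.val + j.val + 1 = 2 then (1 : L) else 0)).Local v × (cmDatum L 1 (Matrix.of fun i j : Fin 1 => if i.val + j.val + 1 = 1 then (1 : L) else 0)).Local v), MeasurableSpace (((cmDatum L 2 (Matrix.of fun i j : Fin 2 => if i.val + j.val + 1 = 2 then (1 : L) else 0)).Local v × (cmDatum L 1 (Matrix.of fun i j : Fin 1 => if i.val + j.val + 1 = 1 then (1 : L) else 0)).Local v) ⧸ Subgroup.centralizer ({a} : Set ((cmDatum L 2 (Matrix.of fun i j : Fin 2 => if i.val + j.val + 1 = 2 then (1 : L) else 0)).Local v × (cmDatum L 1 (Matrix.of fun i j : Fin 1 => if i.val + j.val + 1 = 1 then (1 : L) else 0)).Local v)))]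
    [∀ a : ((cmDatum L 2 (Matrix.of fun i j : Fin 2 => if i.val + j.val + 1 = 2 then (1 : L) else 0)).Local v × (cmDatum L 1 (Matrix.of fun i j : Fin 1 => if i.val + j.val + 1 = 1 then (1 : L) else 0)).Local v), BorelSpace (((cmDatum L 2 (Matrix.of fun i j : Fin 2 => if i.val + j.val + 1 = 2 then (1 : L) else 0)).Local v × (cmDatum L 1 (Matrix.of fun i j : Fin 1 => if i.val + j.val + 1 = 1 then (1 : L) else 0)).Local v) ⧸ Subgroup.centralizer ({a} : Set ((cmDatum L 2 (Matrix.of fun i j : Fin 2 => if i.val + j.val + 1 = 2 then (1 : L) else 0)).Local v × (cmDatum L 1 (Matrix.of fun i j : Fin 1 => if i.val + j.val + 1 = 1 then (1 : L) else 0)).Local v)))]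
    (νH : Measure ((cmDatum L 2 (Matrix.of fun i j : Fin 2 => if i.val + j.val + 1 = 2 then (1 : L) else 0)).Local v × (cmDatum L 1 (Matrix.of fun i j : Fin 1 => if i.val + j.val + 1 = 1 then (1 : L) else 0)).Local v)) [νH.IsHaarMeasure] [νH.IsMulRightInvariant]
    {P_H : ((cmDatum L 2 (Matrix.of fun i j : Fin 2 => if i.val + j.val + 1 = 2 then (1 : L) else 0)).Local v × (cmDatum L 1 (Matrix.of fun i j : Fin 1 => if i.val + j.val + 1 = 1 then (1 : L) else 0)).Local v) → Prop} {mH : OrbitalMeasureFamily ((cmDatum L 2 (Matrix.of fun i j : Fin 2 => if i.val + j.val + 1 = 2 then (1 : L) else 0)).Local v × (cmDatum L 1 (Matrix.of fun i j : Fin 1 => if i.val + j.val + 1 = 1 then (1 : L) else 0)).Local v)} (hmH : mH.IsCanonical P_H νH)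
    (he : v.asIdeal.ramificationIdx' w.1.asIdeal ≠ 1) (h2w : Valued.v (2 : w.1.adicCompletion L) = 1)
    (t : ↥(cmBorelTriple L 2 v).M) {d : Fin 2 → (LocalRing L v)ˣ}
    (hd : glDiagonal 2 (LocalRing L v) d = ((t : ↥(unitaryGroupOfForm (conjLocal L (IsCMField.complexConj L) v) (cmLocalForm L 2 v))) : GL (Fin 2) (LocalRing L v)))
    (hb : IsUnit ((((d 0)⁻¹ * d 1 : (LocalRing L v)ˣ) : LocalRing L v) - 1))
    (hreg₂ : IsRegularElt ((t : ↥(unitaryGroupOfForm (conjLocal L (IsCMField.complexConj L) v) (cmLocalForm L 2 v))) : GL (Fin 2) (LocalRing L v)))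
    (ht1 : ∀ i : Fin 2, Valued.v ((((d i : (LocalRing L v)ˣ) : LocalRing L v) w) - 1) < 1)
    (u : (cmDatum L 1 (Matrix.of fun i j : Fin 1 => if i.val + j.val + 1 = 1 then (1 : L) else 0)).Local v) (hPH : P_H (Quotient.out (ConjClasses.mk (((t : ↥(unitaryGroupOfForm (conjLocal L (IsCMField.complexConj L) v) (cmLocalForm L 2 v))) : (cmDatum L 2 (Matrix.of fun i j : Fin 2 => if i.val + j.val + 1 = 2 then (1 : L) else 0)).Local v), u))))
    (hK₁ : ∀ x : (cmDatum L 1 (Matrix.of fun i j : Fin 1 => if i.val + j.val + 1 = 1 then (1 : L) else 0)).Local v, x ∈ cmLocalIntegralLevel L 1 (Matrix.of fun i j : Fin 1 => if i.val + j.val + 1 = 1 then (1 : L) else 0) v)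
    (χdec : ∀ h : ((cmDatum L 2 (Matrix.of fun i j : Fin 2 => if i.val + j.val + 1 = 2 then (1 : L) else 0)).Local v × (cmDatum L 1 (Matrix.of fun i j : Fin 1 => if i.val + j.val + 1 = 1 then (1 : L) else 0)).Local v), Decidable ((redMat (((h).1.val : GL (Fin 2) (UnitaryGroup.LocalRing L v)).val.map (Pi.evalRingHom (fun w' : PlacesOver L v => w'.1.adicCompletion L) w)) - 1) ^ 2 = 0 ∧ (redMat (((h).1.val : GL (Fin 2) (UnitaryGroup.LocalRing L v)).val.map (Pi.evalRingHom (fun w' : PlacesOver L v => w'.1.adicCompletion L) w)) - 1).rank = 0)) :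
    classOrbitalIntegral mH ((((((cmLocalIntegralLevel L 2 (Matrix.of fun i j : Fin 2 => if i.val + j.val + 1 = 2 then (1 : L) else 0) v).prod (cmLocalIntegralLevel L 1 (Matrix.of fun i j : Fin 1 => if i.val + j.val + 1 = 1 then (1 : L) else 0) v)) : Subgroup ((cmDatum L 2 (Matrix.of fun i j : Fin 2 => if i.val + j.val + 1 = 2 then (1 : L) else 0)).Local v × (cmDatum L 1 (Matrix.of fun i j : Fin 1 => if i.val + j.val + 1 = 1 then (1 : L) else 0)).Local v)) : Set ((cmDatum L 2 (Matrix.of fun i j : Fin 2 => if i.val + j.val + 1 = 2 then (1 : L) else 0)).Local v × (cmDatum L 1 (Matrix.of fun i j : Fin 1 => if i.val + j.val + 1 = 1 then (1 : L) else 0)).Local v)).indicator fun h => if (redMat (((h).1.val : GL (Fin 2) (UnitaryGroup.LocalRing L v)).val.map (Pi.evalRingHom (fun w' : PlacesOver L v => w'.1.adicCompletion L) w)) - 1) ^ 2 = 0 ∧ (redMat (((h).1.val : GL (Fin 2) (UnitaryGroup.LocalRing L v)).val.map (Pi.evalRingHom (fun w' : PlacesOver L v => w'.1.adicCompletion L)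 w)) - 1).rank = 0 then (1 : ℂ) else 0))
        (ConjClasses.mk (((t : ↥(unitaryGroupOfForm (conjLocal L (IsCMField.complexConj L) v) (cmLocalForm L 2 v))) : (cmDatum L 2 (Matrix.of fun i j : Fin 2 => if i.val + j.val + 1 = 2 then (1 : L) else 0)).Local v), u)) =
      (νH.real ((((cmLocalIntegralLevel L 2 (Matrix.of fun i j : Fin 2 => if i.val + j.val + 1 = 2 then (1 : L) else 0) v).prod (cmLocalIntegralLevel L 1 (Matrix.of fun i j : Fin 1 => if i.val + j.val + 1 = 1 then (1 : L) else 0) v)) : Subgroup ((cmDatum L 2 (Matrix.of fun i j : Fin 2 => if i.val + j.val + 1 = 2 then (1 : L) else 0)).Local v × (cmDatum L 1 (Matrix.of fun i j : Fin 1 => if i.val + j.val + 1 = 1 then (1 : L) else 0)).Local v)) : Set ((cmDatum L 2 (Matrix.of fun i j : Fin 2 => if i.val + j.val + 1 = 2 then (1 : L) else 0)).Local v × (cmDatum L 1 (Matrix.of fun i j : Fin 1 => if i.val + j.val + 1 = 1 then (1 : L) else 0)).Local v)) : ℂ) *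
        (((letI : MeasurableSpace (LocalRing L v) := borel _; haveI : BorelSpace (LocalRing L v) := ⟨rfl⟩
          haveI : SecondCountableTopology (LocalRing L v) := secondCountableTopology_localRing (E := L) v
          ((skewModulus (conjLocal L (IsCMField.complexConj L) v) (continuous_conjLocal L (IsCMField.complexConj L) v) hb.unit
            (map_unit_torusScalar_sub_one_two (conjLocal L (IsCMField.complexConj L) v) (cmLocalForm_eq_over L 2 v)
              (⟨(t : ↥(unitaryGroupOfForm (conjLocal L (IsCMField.complexConj L) v) (cmLocalForm L 2 v))), t.2⟩ : ↥(torusU (conjLocal L (IsCMField.complexConj L) v) (cmLocalForm L 2 v))) hd hb))⁻¹ : ℝ≥0)) : ℝ≥0) : ℂ) := by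
  haveI : Algebra.IsQuadraticExtension ↥(maximalRealSubfield L) L := IsCMField.isQuadraticExtension L
  -- measurable structures and Haar measures on `U(Φ₂)(L⁺_v) ⊇ K₂, N₂` (they cancel in the end)
  haveI : LocallyCompactSpace ↥(unitaryGroupOfForm (conjLocal L (IsCMField.complexConj L) v) (cmLocalForm L 2 v)) := locallyCompactSpace_local (IsCMField.complexConj L) 2 _ v
  haveI : SecondCountableTopology ↥(unitaryGroupOfForm (conjLocal L (IsCMField.complexConj L) v) (cmLocalForm L 2 v)) := secondCountableTopology_local (IsCMField.complexConj L) 2 _ v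
  letI mU : MeasurableSpace ↥(unitaryGroupOfForm (conjLocal L (IsCMField.complexConj L) v) (cmLocalForm L 2 v)) := borel _
  haveI : BorelSpace ↥(unitaryGroupOfForm (conjLocal L (IsCMField.complexConj L) v) (cmLocalForm L 2 v)) := ⟨rfl⟩
  obtain ⟨K₂, hK2⟩ : ∃ K : Subgroup ↥(unitaryGroupOfForm (conjLocal L (IsCMField.complexConj L) v) (cmLocalForm L 2 v)), K = cmLocalIntegralLevel L 2 (Matrix.of fun i j : Fin 2 => if i.val + j.val + 1 = 2 then (1 : L) else 0) v := ⟨_, rfl⟩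
  have hK2co : IsCompact (K₂ : Set ↥(unitaryGroupOfForm (conjLocal L (IsCMField.complexConj L) v) (cmLocalForm L 2 v))) ∧ IsOpen (K₂ : Set ↥(unitaryGroupOfForm (conjLocal L (IsCMField.complexConj L) v) (cmLocalForm L 2 v))) := by
    rw [hK2]; exact isCompact_isOpen_cmLocalIntegralLevel L 2 (Matrix.of fun i j : Fin 2 => if i.val + j.val + 1 = 2 then (1 : L) else 0) v
  haveI : LocallyCompactSpace ↥K₂ := hK2co.1.isClosed.isClosedEmbedding_subtypeVal.locallyCompactSpace
  haveI : CompactSpace ↥K₂ := isCompact_iff_compactSpace.1 hK2co.1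
  have hN₂ : IsClosed (((unipotentU (conjLocal L (IsCMField.complexConj L) v) (cmLocalForm L 2 v))) : Set ↥(unitaryGroupOfForm (conjLocal L (IsCMField.complexConj L) v) (cmLocalForm L 2 v))) := isClosed_unipotentU _ _
  haveI : LocallyCompactSpace ↥(cmBorelTriple L 2 v).N := hN₂.isClosedEmbedding_subtypeVal.locallyCompactSpace
  haveI : SecondCountableTopology ↥(cmBorelTriple L 2 v).N := TopologicalSpace.Subtype.secondCountableTopology _
  haveI : SigmaCompactSpace ↥(cmBorelTriple L 2 v).N := sigmaCompactSpace_of_locallyCompact_secondCountable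
  obtain ⟨κ₂, hκ₂⟩ : ∃ κ : Measure ↥K₂, κ = Measure.haar := ⟨_, rfl⟩
  haveI : κ₂.IsHaarMeasure := by rw [hκ₂]; infer_instance
  obtain ⟨μN₂, hμN₂⟩ : ∃ μ : Measure ↥(cmBorelTriple L 2 v).N, μ = Measure.haar := ⟨_, rfl⟩
  haveI : μN₂.IsHaarMeasure := by rw [hμN₂]; infer_instance
  haveI : SigmaFinite μN₂ := inferInstance
  -- the class function `χ_s` is measurable (locally constant, ★ END FILE B)
  have hχ : Measurable (((((cmLocalIntegralLevel L 2 (Matrix.of fun i j : Fin 2 => if i.val + j.val + 1 = 2 then (1 : L) else 0) v).prod (cmLocalIntegralLevel L 1 (Matrix.of fun i j : Fin 1 => if i.val + j.val + 1 = 1 then (1 : L) else 0) v)) : Subgroup (((cmDatum L 2 (Matrix.of fun i j : Fin 2 => if i.val + j.val + 1 = 2 then (1 : L) else 0)).Local v) × ((cmDatum L 1 (Matrix.of fun i j : Fin 1 => if i.val + j.val + 1 = 1 then (1 : L) else 0)).Local v))) : Set (((cmDatum L 2 (Matrix.of fun i j : Fin 2 => if i.val + j.val + 1 = 2 then (1 :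 L) else 0)).Local v) × ((cmDatum L 1 (Matrix.of fun i j : Fin 1 => if i.val + j.val + 1 = 1 then (1 : L) else 0)).Local v))).indicator fun h => if (redMat (((h).1.val : GL (Fin 2) (UnitaryGroup.LocalRing L v)).val.map (Pi.evalRingHom (fun w' : PlacesOver L v => w'.1.adicCompletion L) w)) - 1) ^ 2 = 0 ∧ (redMat (((h).1.val : GL (Fin 2) (UnitaryGroup.LocalRing L v)).val.map (Pi.evalRingHom (fun w' : PlacesOver L v => w'.1.adicCompletion L) w)) - 1).rank = 0 then (1 : ℂ) else 0) :=
    (isLocSmooth_indicator_ite_redMat L v w hw 0 χdec).continuous.measurable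
  -- ★ H-descent
  rw [classOrbitalIntegral_prod_eq_smul_integral_prod_of_torus_regular_of_nonsplit L w hw νH hmH K₂ hK2 κ₂ μN₂ t hd hb hreg₂ u hPH hK₁ _ hχ]
  -- positivity ∕ finiteness of `κ₂(K₂)` and `μ(N₂ ∩ K₂)`
  have hκ0 : κ₂ Set.univ ≠ 0 := IsOpenPosMeasure.open_pos _ isOpen_univ Set.univ_nonempty
  have hκt : κ₂ Set.univ ≠ ∞ := (isCompact_univ.measure_lt_top (μ := κ₂)).ne
  have hA0 : μN₂ {n : ↥(cmBorelTriple L 2 v).N | (n : ↥(unitaryGroupOfForm (conjLocal L (IsCMField.complexConj L) v) (cmLocalForm L 2 v))) ∈ K₂} ≠ 0 :=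
    (hK2co.2.preimage continuous_subtype_val).measure_ne_zero μN₂
      ⟨1, by simp only [Set.mem_preimage, OneMemClass.coe_one, SetLike.mem_coe]; exact one_mem _⟩
  have hAt : μN₂ {n : ↥(cmBorelTriple L 2 v).N | (n : ↥(unitaryGroupOfForm (conjLocal L (IsCMField.complexConj L) v) (cmLocalForm L 2 v))) ∈ K₂} ≠ ∞ :=
    (hN₂.isClosedEmbedding_subtypeVal.isCompact_preimage hK2co.1).measure_lt_top.ne
  -- the two spellings of `N₂ ∩ K₂` (`K₂` as a subgroup of `U(Φ₂)(L⁺_v)` ∕ of `H_{2,v}`) agree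
  have hAK : {n : ↥(cmBorelTriple L 2 v).N | (n : ↥(unitaryGroupOfForm (conjLocal L (IsCMField.complexConj L) v) (cmLocalForm L 2 v))) ∈ K₂} = {n : ↥(cmBorelTriple L 2 v).N | (n : ↥(unitaryGroupOfForm (conjLocal L (IsCMField.complexConj L) v) (cmLocalForm L 2 v))) ∈ cmLocalIntegralLevel L 2 (Matrix.of fun i j : Fin 2 => if i.val + j.val + 1 = 2 then (1 : L) else 0) v} := by
    rw [hK2]; rfl
  rw [hAK] at hA0 hAt ⊢
  -- the integrand collapse (§1): the integrand is `1_{S_s}(n)`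
  have hint : (∫ p : ↥K₂ × ↥(cmBorelTriple L 2 v).N,
        (((((cmLocalIntegralLevel L 2 (Matrix.of fun i j : Fin 2 => if i.val + j.val + 1 = 2 then (1 : L) else 0) v).prod (cmLocalIntegralLevel L 1 (Matrix.of fun i j : Fin 1 => if i.val + j.val + 1 = 1 then (1 : L) else 0) v)) : Subgroup (((cmDatum L 2 (Matrix.of fun i j : Fin 2 => if i.val + j.val + 1 = 2 then (1 : L) else 0)).Local v) × ((cmDatum L 1 (Matrix.of fun i j : Fin 1 => if i.val + j.val + 1 = 1 then (1 : L) else 0)).Local v))) : Set (((cmDatum L 2 (Matrix.of fun i j : Fin 2 => if i.val + j.val + 1 = 2 then (1 : L) else 0)).Local v) × ((cmDatum L 1 (Matrix.of fun i j : Fin 1 => if i.val + j.val + 1 = 1 then (1 : L) else 0)).Local v))).indicator fun h => if (redMat (((h).1.val : GL (Fin 2) (UnitaryGroup.LocalRing L v)).val.map (Pi.evalRingHom (fun w' : PlacesOver L v => w'.1.adicCompletion L) w)) - 1) ^ 2 = 0 ∧ (redMat (((h).1.val : GL (Fin 2) (UnitaryGroup.LocalRing L v)).val.map (Pi.evalRingHom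 (fun w' : PlacesOver L v => w'.1.adicCompletion L) w)) - 1).rank = 0 then (1 : ℂ) else 0)
          (((((p.1 : ↥(unitaryGroupOfForm (conjLocal L (IsCMField.complexConj L) v) (cmLocalForm L 2 v))) * ((t : ↥(unitaryGroupOfForm (conjLocal L (IsCMField.complexConj L) v) (cmLocalForm L 2 v))) * (p.2 : ↥(unitaryGroupOfForm (conjLocal L (IsCMField.complexConj L) v) (cmLocalForm L 2 v))))) * (p.1 : ↥(unitaryGroupOfForm (conjLocal L (IsCMField.complexConj L) v) (cmLocalForm L 2 v)))⁻¹ : ↥(unitaryGroupOfForm (conjLocal L (IsCMField.complexConj L) v) (cmLocalForm L 2 v))) : ((cmDatum L 2 (Matrix.of fun i j : Fin 2 => if i.val + j.val + 1 = 2 then (1 : L) else 0)).Local v)), u) ∂(κ₂.prod μN₂)) =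
      ∫ p : ↥K₂ × ↥(cmBorelTriple L 2 v).N, ({n : ↥(cmBorelTriple L 2 v).N | (n : ↥(unitaryGroupOfForm (conjLocal L (IsCMField.complexConj L) v) (cmLocalForm L 2 v))) ∈ cmLocalIntegralLevel L 2 (Matrix.of fun i j : Fin 2 => if i.val + j.val + 1 = 2 then (1 : L) else 0) v ∧ ((redMat ((((n : ↥(unitaryGroupOfForm (conjLocal L (IsCMField.complexConj L) v) (cmLocalForm L 2 v))) : GL (Fin 2) (LocalRing L v)).val.map (Pi.evalRingHom (fun w' : PlacesOver L v => w'.1.adicCompletion L) w))) - 1) ^ 2 = 0 ∧ (redMat ((((n : ↥(unitaryGroupOfForm (conjLocal L (IsCMField.complexConj L) v) (cmLocalForm L 2 v))) : GL (Fin 2) (LocalRing L v)).val.map (Pi.evalRingHom (fun w' : PlacesOver L v => w'.1.adicCompletion L) w))) - 1).rank = 0)}).indicator (fun _ => (1 : ℂ)) p.2 ∂(κ₂.prod μN₂) := by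
    congr 1
    funext p
    exact indicator_ite_redMat_conj_torus_mul_eq L v w hw 0 χdec hK₁ (k := (p.1 : ↥(unitaryGroupOfForm (conjLocal L (IsCMField.complexConj L) v) (cmLocalForm L 2 v)))) (by rw [← hK2]; exact p.1.2) t hd ht1 p.2 u
  -- `S_s` is measurable: the preimage of a ball∕sphere of `L_w` under the continuous coordinate `n ↦ n₀₁,w`
  have hcont : Continuous fun n : ↥(cmBorelTriple L 2 v).N => (((((n : ↥(unitaryGroupOfForm (conjLocal L (IsCMField.complexConj L) v) (cmLocalForm L 2 v))) : GL (Fin 2) (LocalRing L v)) : Matrix (Fin 2) (Fin 2) (LocalRing L v)) 0 1) w) :=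
    (continuous_apply w).comp (continuous_umat_zero_one_two (conjLocal L (IsCMField.complexConj L) v))
  have hSmeas : MeasurableSet ({n : ↥(cmBorelTriple L 2 v).N | (n : ↥(unitaryGroupOfForm (conjLocal L (IsCMField.complexConj L) v) (cmLocalForm L 2 v))) ∈ cmLocalIntegralLevel L 2 (Matrix.of fun i j : Fin 2 => if i.val + j.val + 1 = 2 then (1 : L) else 0) v ∧ ((redMat ((((n : ↥(unitaryGroupOfForm (conjLocal L (IsCMField.complexConj L) v) (cmLocalForm L 2 v))) : GL (Fin 2) (LocalRing L v)).val.map (Pi.evalRingHom (fun w' : PlacesOver L v => w'.1.adicCompletion L) w))) - 1) ^ 2 = 0 ∧ (redMat ((((n : ↥(unitaryGroupOfForm (conjLocal L (IsCMField.complexConj L) v) (cmLocalForm L 2 v))) : GL (Fin 2) (LocalRing L v)).val.map (Pi.evalRingHom (fun w' : PlacesOver L v => w'.1.adicCompletion L) w))) - 1).rank = 0)}) := by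
    have hS : ({n : ↥(cmBorelTriple L 2 v).N | (n : ↥(unitaryGroupOfForm (conjLocal L (IsCMField.complexConj L) v) (cmLocalForm L 2 v))) ∈ cmLocalIntegralLevel L 2 (Matrix.of fun i j : Fin 2 => if i.val + j.val + 1 = 2 then (1 : L) else 0) v ∧ ((redMat ((((n : ↥(unitaryGroupOfForm (conjLocal L (IsCMField.complexConj L) v) (cmLocalForm L 2 v))) : GL (Fin 2) (LocalRing L v)).val.map (Pi.evalRingHom (fun w' : PlacesOver L v => w'.1.adicCompletion L) w))) - 1) ^ 2 = 0 ∧ (redMat ((((n : ↥(unitaryGroupOfForm (conjLocal L (IsCMField.complexConj L) v) (cmLocalForm L 2 v))) : GL (Fin 2) (LocalRing L v)).val.map (Pi.evalRingHom (fun w' : PlacesOver L v => w'.1.adicCompletion L) w))) - 1).rank = 0)}) =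
        (fun n : ↥(cmBorelTriple L 2 v).N => (((((n : ↥(unitaryGroupOfForm (conjLocal L (IsCMField.complexConj L) v) (cmLocalForm L 2 v))) : GL (Fin 2) (LocalRing L v)) : Matrix (Fin 2) (Fin 2) (LocalRing L v)) 0 1) w)) ⁻¹' {z : w.1.adicCompletion L | Valued.v z < 1} := by
      ext n
      simp only [Set.mem_setOf_eq, Set.mem_preimage]
      rw [unipotent_mem_cmLocalIntegralLevel_iff L v w hw]
      constructor
      · rintro ⟨hle, -, h0⟩
        exact (rank_redMat_unipotent_sub_one_eq_zero_iff L v w n hle).1 h0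
      · intro hlt
        exact ⟨hlt.le, sq_redMat_unipotent_sub_one L v w n, (rank_redMat_unipotent_sub_one_eq_zero_iff L v w n hlt.le).2 hlt⟩
    rw [hS]
    exact ((isOpen_setOf_valued_lt_one L v w).preimage hcont).measurableSet
  -- evaluate the Iwasawa integral: `κ₂(K₂) · μ(S_s)`
  rw [hint, integral_fun_snd, integral_indicator_const (1 : ℂ) hSmeas, measureReal_lineStratum_zero_of_ramified L v w hw μN₂ he h2w, smul_smul, smul_smul,
    Complex.real_smul, mul_one]
  -- cancel `κ₂(K₂)` and `μ(N₂ ∩ K₂)` (both positive and finite)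
  have hB : (((κ₂ Set.univ).toReal : ℝ) : ℂ) ≠ 0 := by exact_mod_cast ENNReal.toReal_ne_zero.2 ⟨hκ0, hκt⟩
  have hC : (((μN₂ {n : ↥(cmBorelTriple L 2 v).N | (n : ↥(unitaryGroupOfForm (conjLocal L (IsCMField.complexConj L) v) (cmLocalForm L 2 v))) ∈ cmLocalIntegralLevel L 2 (Matrix.of fun i j : Fin 2 => if i.val + j.val + 1 = 2 then (1 : L) else 0) v}).toReal : ℝ) : ℂ) ≠ 0 := by
    exact_mod_cast ENNReal.toReal_ne_zero.2 ⟨hA0, hAt⟩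
  have hq : (Ideal.absNorm v.asIdeal : ℂ) ≠ 0 := Nat.cast_ne_zero.2 fun h => v.ne_bot (Ideal.absNorm_eq_zero_iff.1 h)
  have hJ : (((letI : MeasurableSpace (LocalRing L v) := borel _; haveI : BorelSpace (LocalRing L v) := ⟨rfl⟩
          haveI : SecondCountableTopology (LocalRing L v) := secondCountableTopology_localRing (E := L) v
          (skewModulus (conjLocal L (IsCMField.complexConj L) v) (continuous_conjLocal L (IsCMField.complexConj L) v) hb.unit
            (map_unit_torusScalar_sub_one_two (conjLocal L (IsCMField.complexConj L) v) (cmLocalForm_eq_over L 2 v)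
              (⟨(t : ↥(unitaryGroupOfForm (conjLocal L (IsCMField.complexConj L) v) (cmLocalForm L 2 v))), t.2⟩ : ↥(torusU (conjLocal L (IsCMField.complexConj L) v) (cmLocalForm L 2 v))) hd hb)) : ℝ≥0) : ℝ) : ℂ) ≠ 0 := by
    letI : MeasurableSpace (LocalRing L v) := borel _
    haveI : BorelSpace (LocalRing L v) := ⟨rfl⟩
    haveI : SecondCountableTopology (LocalRing L v) := secondCountableTopology_localRing (E := L) v
    exact_mod_cast (skewModulus_pos (conjLocal L (IsCMField.complexConj L) v) (continuous_conjLocal L (IsCMField.complexConj L) v) _ _).ne'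
  simp only [measureReal_def, ENNReal.toReal_mul, ENNReal.toReal_div, ENNReal.coe_toReal]
  push_cast
  field_simp

set_option maxHeartbeats 3200000 in
set_option synthInstance.maxHeartbeats 400000 in
-- instance-term unification on the CM local carriers, as above
include hw in
/-- **(δ)-RAM HEAD (χ₁): `Φ_H(⟦(t, u)⟧, χ₁) = 0`** at a TAME-RAMIFIED non-split `w` (the rank-1 line stratum is empty, ★ `lineStratum_one_eq_empty_of_ramified`) for HEAD v4's `χ₁ = 1_{K_H}·[(red h_{W,w} − 1)² = 0 ∧ rank(red h_{W,w} − 1) = 1]`, same frame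
as the `χ₀` head (rank-1 line stratum EMPTY). [cite: Rogawski1990, §4.9 Prop. 4.9.1 (b) p. 55; §4.3 (4.3.1) p. 43] [cite: Flicker1998UnitaryFL, §2] -/
theorem classOrbitalIntegral_chiOne_eq_zero_of_torus_deep_ramified
    [MeasurableSpace ((cmDatum L 2 (Matrix.of fun i j : Fin 2 => if i.val + j.val + 1 = 2 then (1 : L) else 0)).Local v × (cmDatum L 1 (Matrix.of fun i j : Fin 1 => if i.val + j.val + 1 = 1 then (1 : L) else 0)).Local v)] [BorelSpace ((cmDatum L 2 (Matrix.of fun i j : Fin 2 => if i.val + j.val + 1 = 2 then (1 : L) else 0)).Local v × (cmDatum L 1 (Matrix.of fun i j : Fin 1 => if i.val + j.val + 1 = 1 then (1 : L) else 0)).Local v)]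
    [∀ a : ((cmDatum L 2 (Matrix.of fun i j : Fin 2 => if i.val + j.val + 1 = 2 then (1 : L) else 0)).Local v × (cmDatum L 1 (Matrix.of fun i j : Fin 1 => if i.val + j.val + 1 = 1 then (1 : L) else 0)).Local v), MeasurableSpace (((cmDatum L 2 (Matrix.of fun i j : Fin 2 => if i.val + j.val + 1 = 2 then (1 : L) else 0)).Local v × (cmDatum L 1 (Matrix.of fun i j : Fin 1 => if i.val + j.val + 1 = 1 then (1 : L) else 0)).Local v) ⧸ Subgroup.centralizer ({a} : Set ((cmDatum L 2 (Matrix.of fun i j : Fin 2 => if i.val + j.val + 1 = 2 then (1 : L) else 0)).Local v × (cmDatum L 1 (Matrix.of fun i j : Fin 1 => if i.val + j.val + 1 = 1 then (1 : L) else 0)).Local v)))]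
    [∀ a : ((cmDatum L 2 (Matrix.of fun i j : Fin 2 => if i.val + j.val + 1 = 2 then (1 : L) else 0)).Local v × (cmDatum L 1 (Matrix.of fun i j : Fin 1 => if i.val + j.val + 1 = 1 then (1 : L) else 0)).Local v), BorelSpace (((cmDatum L 2 (Matrix.of fun i j : Fin 2 => if i.val + j.val + 1 = 2 then (1 : L) else 0)).Local v × (cmDatum L 1 (Matrix.of fun i j : Fin 1 => if i.val + j.val + 1 = 1 then (1 : L) else 0)).Local v) ⧸ Subgroup.centralizer ({a} : Set ((cmDatum L 2 (Matrix.of fun i j : Fin 2 => if i.val + j.val + 1 = 2 then (1 : L) else 0)).Local v × (cmDatum L 1 (Matrix.of fun i j : Fin 1 => if i.val + j.val + 1 = 1 then (1 : L) else 0)).Local v)))]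
    (νH : Measure ((cmDatum L 2 (Matrix.of fun i j : Fin 2 => if i.val + j.val + 1 = 2 then (1 : L) else 0)).Local v × (cmDatum L 1 (Matrix.of fun i j : Fin 1 => if i.val + j.val + 1 = 1 then (1 : L) else 0)).Local v)) [νH.IsHaarMeasure] [νH.IsMulRightInvariant]
    {P_H : ((cmDatum L 2 (Matrix.of fun i j : Fin 2 => if i.val + j.val + 1 = 2 then (1 : L) else 0)).Local v × (cmDatum L 1 (Matrix.of fun i j : Fin 1 => if i.val + j.val + 1 = 1 then (1 : L) else 0)).Local v) → Prop} {mH : OrbitalMeasureFamily ((cmDatum L 2 (Matrix.of fun i j : Fin 2 => if i.val + j.val + 1 = 2 then (1 : L) else 0)).Local v × (cmDatum L 1 (Matrix.of fun i j : Fin 1 => if i.val + j.val + 1 = 1 then (1 : L) else 0)).Local v)} (hmH : mH.IsCanonical P_H νH)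
    (he : v.asIdeal.ramificationIdx' w.1.asIdeal ≠ 1) (h2w : Valued.v (2 : w.1.adicCompletion L) = 1)
    (t : ↥(cmBorelTriple L 2 v).M) {d : Fin 2 → (LocalRing L v)ˣ}
    (hd : glDiagonal 2 (LocalRing L v) d = ((t : ↥(unitaryGroupOfForm (conjLocal L (IsCMField.complexConj L) v) (cmLocalForm L 2 v))) : GL (Fin 2) (LocalRing L v)))
    (hb : IsUnit ((((d 0)⁻¹ * d 1 : (LocalRing L v)ˣ) : LocalRing L v) - 1))
    (hreg₂ : IsRegularElt ((t : ↥(unitaryGroupOfForm (conjLocal L (IsCMField.complexConj L) v) (cmLocalForm L 2 v))) : GL (Fin 2) (LocalRing L v)))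
    (ht1 : ∀ i : Fin 2, Valued.v ((((d i : (LocalRing L v)ˣ) : LocalRing L v) w) - 1) < 1)
    (u : (cmDatum L 1 (Matrix.of fun i j : Fin 1 => if i.val + j.val + 1 = 1 then (1 : L) else 0)).Local v) (hPH : P_H (Quotient.out (ConjClasses.mk (((t : ↥(unitaryGroupOfForm (conjLocal L (IsCMField.complexConj L) v) (cmLocalForm L 2 v))) : (cmDatum L 2 (Matrix.of fun i j : Fin 2 => if i.val + j.val + 1 = 2 then (1 : L) else 0)).Local v), u))))
    (hK₁ : ∀ x : (cmDatum L 1 (Matrix.of fun i j : Fin 1 => if i.val + j.val + 1 = 1 then (1 : L) else 0)).Local v, x ∈ cmLocalIntegralLevel L 1 (Matrix.of fun i j : Fin 1 => if i.val + j.val + 1 = 1 then (1 : L) else 0) v)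
    (χdec : ∀ h : ((cmDatum L 2 (Matrix.of fun i j : Fin 2 => if i.val + j.val + 1 = 2 then (1 : L) else 0)).Local v × (cmDatum L 1 (Matrix.of fun i j : Fin 1 => if i.val + j.val + 1 = 1 then (1 : L) else 0)).Local v), Decidable ((redMat (((h).1.val : GL (Fin 2) (UnitaryGroup.LocalRing L v)).val.map (Pi.evalRingHom (fun w' : PlacesOver L v => w'.1.adicCompletion L) w)) - 1) ^ 2 = 0 ∧ (redMat (((h).1.val : GL (Fin 2) (UnitaryGroup.LocalRing L v)).val.map (Pi.evalRingHom (fun w' : PlacesOver L v => w'.1.adicCompletion L) w)) - 1).rank = 1)) :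
    classOrbitalIntegral mH ((((((cmLocalIntegralLevel L 2 (Matrix.of fun i j : Fin 2 => if i.val + j.val + 1 = 2 then (1 : L) else 0) v).prod (cmLocalIntegralLevel L 1 (Matrix.of fun i j : Fin 1 => if i.val + j.val + 1 = 1 then (1 : L) else 0) v)) : Subgroup ((cmDatum L 2 (Matrix.of fun i j : Fin 2 => if i.val + j.val + 1 = 2 then (1 : L) else 0)).Local v × (cmDatum L 1 (Matrix.of fun i j : Fin 1 => if i.val + j.val + 1 = 1 then (1 : L) else 0)).Local v)) : Set ((cmDatum L 2 (Matrix.of fun i j : Fin 2 => if i.val + j.val + 1 = 2 then (1 : L) else 0)).Local v × (cmDatum L 1 (Matrix.of fun i j : Fin 1 => if i.val + j.val + 1 = 1 then (1 : L) else 0)).Local v)).indicator fun h => if (redMat (((h).1.val : GL (Fin 2) (UnitaryGroup.LocalRing L v)).val.map (Pi.evalRingHom (fun w' : PlacesOver L v => w'.1.adicCompletion L) w)) - 1) ^ 2 = 0 ∧ (redMat (((h).1.val : GL (Fin 2) (UnitaryGroup.LocalRing L v)).val.map (Pi.evalRingHom (fun w' : PlacesOver L v => w'.1.adicCompletion L)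 w)) - 1).rank = 1 then (1 : ℂ) else 0))
        (ConjClasses.mk (((t : ↥(unitaryGroupOfForm (conjLocal L (IsCMField.complexConj L) v) (cmLocalForm L 2 v))) : (cmDatum L 2 (Matrix.of fun i j : Fin 2 => if i.val + j.val + 1 = 2 then (1 : L) else 0)).Local v), u)) = 0 := by
  haveI : Algebra.IsQuadraticExtension ↥(maximalRealSubfield L) L := IsCMField.isQuadraticExtension L
  -- measurable structures and Haar measures on `U(Φ₂)(L⁺_v) ⊇ K₂, N₂` (they cancel in the end)
  haveI : LocallyCompactSpace ↥(unitaryGroupOfForm (conjLocal L (IsCMField.complexConj L) v) (cmLocalForm L 2 v)) := locallyCompactSpace_local (IsCMField.complexConj L) 2 _ v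
  haveI : SecondCountableTopology ↥(unitaryGroupOfForm (conjLocal L (IsCMField.complexConj L) v) (cmLocalForm L 2 v)) := secondCountableTopology_local (IsCMField.complexConj L) 2 _ v
  letI mU : MeasurableSpace ↥(unitaryGroupOfForm (conjLocal L (IsCMField.complexConj L) v) (cmLocalForm L 2 v)) := borel _
  haveI : BorelSpace ↥(unitaryGroupOfForm (conjLocal L (IsCMField.complexConj L) v) (cmLocalForm L 2 v)) := ⟨rfl⟩
  obtain ⟨K₂, hK2⟩ : ∃ K : Subgroup ↥(unitaryGroupOfForm (conjLocal L (IsCMField.complexConj L) v) (cmLocalForm L 2 v)), K = cmLocalIntegralLevel L 2 (Matrix.of fun i j : Fin 2 => if i.val + j.val + 1 = 2 then (1 : L) else 0) v := ⟨_, rfl⟩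
  have hK2co : IsCompact (K₂ : Set ↥(unitaryGroupOfForm (conjLocal L (IsCMField.complexConj L) v) (cmLocalForm L 2 v))) ∧ IsOpen (K₂ : Set ↥(unitaryGroupOfForm (conjLocal L (IsCMField.complexConj L) v) (cmLocalForm L 2 v))) := by
    rw [hK2]; exact isCompact_isOpen_cmLocalIntegralLevel L 2 (Matrix.of fun i j : Fin 2 => if i.val + j.val + 1 = 2 then (1 : L) else 0) v
  haveI : LocallyCompactSpace ↥K₂ := hK2co.1.isClosed.isClosedEmbedding_subtypeVal.locallyCompactSpace
  haveI : CompactSpace ↥K₂ := isCompact_iff_compactSpace.1 hK2co.1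
  have hN₂ : IsClosed (((unipotentU (conjLocal L (IsCMField.complexConj L) v) (cmLocalForm L 2 v))) : Set ↥(unitaryGroupOfForm (conjLocal L (IsCMField.complexConj L) v) (cmLocalForm L 2 v))) := isClosed_unipotentU _ _
  haveI : LocallyCompactSpace ↥(cmBorelTriple L 2 v).N := hN₂.isClosedEmbedding_subtypeVal.locallyCompactSpace
  haveI : SecondCountableTopology ↥(cmBorelTriple L 2 v).N := TopologicalSpace.Subtype.secondCountableTopology _
  haveI : SigmaCompactSpace ↥(cmBorelTriple L 2 v).N := sigmaCompactSpace_of_locallyCompact_secondCountable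
  obtain ⟨κ₂, hκ₂⟩ : ∃ κ : Measure ↥K₂, κ = Measure.haar := ⟨_, rfl⟩
  haveI : κ₂.IsHaarMeasure := by rw [hκ₂]; infer_instance
  obtain ⟨μN₂, hμN₂⟩ : ∃ μ : Measure ↥(cmBorelTriple L 2 v).N, μ = Measure.haar := ⟨_, rfl⟩
  haveI : μN₂.IsHaarMeasure := by rw [hμN₂]; infer_instance
  haveI : SigmaFinite μN₂ := inferInstance
  -- the class function `χ_s` is measurable (locally constant, ★ END FILE B)
  have hχ : Measurable (((((cmLocalIntegralLevel L 2 (Matrix.of fun i j : Fin 2 => if i.val + j.val + 1 = 2 then (1 : L) else 0) v).prod (cmLocalIntegralLevel L 1 (Matrix.of fun i j : Fin 1 => if i.val + j.val + 1 = 1 then (1 : L) else 0) v)) : Subgroup (((cmDatum L 2 (Matrix.of fun i j : Fin 2 => if i.val + j.val + 1 = 2 then (1 : L) else 0)).Local v) × ((cmDatum L 1 (Matrix.of fun i j : Fin 1 => if i.val + j.val + 1 = 1 then (1 : L) else 0)).Local v))) : Set (((cmDatum L 2 (Matrix.of fun i j : Fin 2 => if i.val + j.val + 1 = 2 then (1 :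 L) else 0)).Local v) × ((cmDatum L 1 (Matrix.of fun i j : Fin 1 => if i.val + j.val + 1 = 1 then (1 : L) else 0)).Local v))).indicator fun h => if (redMat (((h).1.val : GL (Fin 2) (UnitaryGroup.LocalRing L v)).val.map (Pi.evalRingHom (fun w' : PlacesOver L v => w'.1.adicCompletion L) w)) - 1) ^ 2 = 0 ∧ (redMat (((h).1.val : GL (Fin 2) (UnitaryGroup.LocalRing L v)).val.map (Pi.evalRingHom (fun w' : PlacesOver L v => w'.1.adicCompletion L) w)) - 1).rank = 1 then (1 : ℂ) else 0) :=
    (isLocSmooth_indicator_ite_redMat L v w hw 1 χdec).continuous.measurable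
  -- ★ H-descent
  rw [classOrbitalIntegral_prod_eq_smul_integral_prod_of_torus_regular_of_nonsplit L w hw νH hmH K₂ hK2 κ₂ μN₂ t hd hb hreg₂ u hPH hK₁ _ hχ]
  -- positivity ∕ finiteness of `κ₂(K₂)` and `μ(N₂ ∩ K₂)`
  have hκ0 : κ₂ Set.univ ≠ 0 := IsOpenPosMeasure.open_pos _ isOpen_univ Set.univ_nonempty
  have hκt : κ₂ Set.univ ≠ ∞ := (isCompact_univ.measure_lt_top (μ := κ₂)).ne
  have hA0 : μN₂ {n : ↥(cmBorelTriple L 2 v).N | (n : ↥(unitaryGroupOfForm (conjLocal L (IsCMField.complexConj L) v) (cmLocalForm L 2 v))) ∈ K₂} ≠ 0 :=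
    (hK2co.2.preimage continuous_subtype_val).measure_ne_zero μN₂
      ⟨1, by simp only [Set.mem_preimage, OneMemClass.coe_one, SetLike.mem_coe]; exact one_mem _⟩
  have hAt : μN₂ {n : ↥(cmBorelTriple L 2 v).N | (n : ↥(unitaryGroupOfForm (conjLocal L (IsCMField.complexConj L) v) (cmLocalForm L 2 v))) ∈ K₂} ≠ ∞ :=
    (hN₂.isClosedEmbedding_subtypeVal.isCompact_preimage hK2co.1).measure_lt_top.ne
  -- the two spellings of `N₂ ∩ K₂` (`K₂` as a subgroup of `U(Φ₂)(L⁺_v)` ∕ of `H_{2,v}`) agree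
  have hAK : {n : ↥(cmBorelTriple L 2 v).N | (n : ↥(unitaryGroupOfForm (conjLocal L (IsCMField.complexConj L) v) (cmLocalForm L 2 v))) ∈ K₂} = {n : ↥(cmBorelTriple L 2 v).N | (n : ↥(unitaryGroupOfForm (conjLocal L (IsCMField.complexConj L) v) (cmLocalForm L 2 v))) ∈ cmLocalIntegralLevel L 2 (Matrix.of fun i j : Fin 2 => if i.val + j.val + 1 = 2 then (1 : L) else 0) v} := by
    rw [hK2]; rfl
  rw [hAK] at hA0 hAt ⊢
  -- the integrand collapse (§1): the integrand is `1_{S_s}(n)`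
  have hint : (∫ p : ↥K₂ × ↥(cmBorelTriple L 2 v).N,
        (((((cmLocalIntegralLevel L 2 (Matrix.of fun i j : Fin 2 => if i.val + j.val + 1 = 2 then (1 : L) else 0) v).prod (cmLocalIntegralLevel L 1 (Matrix.of fun i j : Fin 1 => if i.val + j.val + 1 = 1 then (1 : L) else 0) v)) : Subgroup (((cmDatum L 2 (Matrix.of fun i j : Fin 2 => if i.val + j.val + 1 = 2 then (1 : L) else 0)).Local v) × ((cmDatum L 1 (Matrix.of fun i j : Fin 1 => if i.val + j.val + 1 = 1 then (1 : L) else 0)).Local v))) : Set (((cmDatum L 2 (Matrix.of fun i j : Fin 2 => if i.val + j.val + 1 = 2 then (1 : L) else 0)).Local v) × ((cmDatum L 1 (Matrix.of fun i j : Fin 1 => if i.val + j.val + 1 = 1 then (1 : L) else 0)).Local v))).indicator fun h => if (redMat (((h).1.val : GL (Fin 2) (UnitaryGroup.LocalRing L v)).val.map (Pi.evalRingHom (fun w' : PlacesOver L v => w'.1.adicCompletion L) w)) - 1) ^ 2 = 0 ∧ (redMat (((h).1.val : GL (Fin 2) (UnitaryGroup.LocalRing L v)).val.map (Pi.evalRingHom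 (fun w' : PlacesOver L v => w'.1.adicCompletion L) w)) - 1).rank = 1 then (1 : ℂ) else 0)
          (((((p.1 : ↥(unitaryGroupOfForm (conjLocal L (IsCMField.complexConj L) v) (cmLocalForm L 2 v))) * ((t : ↥(unitaryGroupOfForm (conjLocal L (IsCMField.complexConj L) v) (cmLocalForm L 2 v))) * (p.2 : ↥(unitaryGroupOfForm (conjLocal L (IsCMField.complexConj L) v) (cmLocalForm L 2 v))))) * (p.1 : ↥(unitaryGroupOfForm (conjLocal L (IsCMField.complexConj L) v) (cmLocalForm L 2 v)))⁻¹ : ↥(unitaryGroupOfForm (conjLocal L (IsCMField.complexConj L) v) (cmLocalForm L 2 v))) : ((cmDatum L 2 (Matrix.of fun i j : Fin 2 => if i.val + j.val + 1 = 2 then (1 : L) else 0)).Local v)), u) ∂(κ₂.prod μN₂)) =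
      ∫ p : ↥K₂ × ↥(cmBorelTriple L 2 v).N, ({n : ↥(cmBorelTriple L 2 v).N | (n : ↥(unitaryGroupOfForm (conjLocal L (IsCMField.complexConj L) v) (cmLocalForm L 2 v))) ∈ cmLocalIntegralLevel L 2 (Matrix.of fun i j : Fin 2 => if i.val + j.val + 1 = 2 then (1 : L) else 0) v ∧ ((redMat ((((n : ↥(unitaryGroupOfForm (conjLocal L (IsCMField.complexConj L) v) (cmLocalForm L 2 v))) : GL (Fin 2) (LocalRing L v)).val.map (Pi.evalRingHom (fun w' : PlacesOver L v => w'.1.adicCompletion L) w))) - 1) ^ 2 = 0 ∧ (redMat ((((n : ↥(unitaryGroupOfForm (conjLocal L (IsCMField.complexConj L) v) (cmLocalForm L 2 v))) : GL (Fin 2) (LocalRing L v)).val.map (Pi.evalRingHom (fun w' : PlacesOver L v => w'.1.adicCompletion L) w))) - 1).rank = 1)}).indicator (fun _ => (1 : ℂ)) p.2 ∂(κ₂.prod μN₂) := by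
    congr 1
    funext p
    exact indicator_ite_redMat_conj_torus_mul_eq L v w hw 1 χdec hK₁ (k := (p.1 : ↥(unitaryGroupOfForm (conjLocal L (IsCMField.complexConj L) v) (cmLocalForm L 2 v)))) (by rw [← hK2]; exact p.1.2) t hd ht1 p.2 u
  -- `S_s` is measurable: the preimage of a ball∕sphere of `L_w` under the continuous coordinate `n ↦ n₀₁,w`
  have hcont : Continuous fun n : ↥(cmBorelTriple L 2 v).N => (((((n : ↥(unitaryGroupOfForm (conjLocal L (IsCMField.complexConj L) v) (cmLocalForm L 2 v))) : GL (Fin 2) (LocalRing L v)) : Matrix (Fin 2) (Fin 2) (LocalRing L v)) 0 1) w) :=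
    (continuous_apply w).comp (continuous_umat_zero_one_two (conjLocal L (IsCMField.complexConj L) v))
  have hSmeas : MeasurableSet ({n : ↥(cmBorelTriple L 2 v).N | (n : ↥(unitaryGroupOfForm (conjLocal L (IsCMField.complexConj L) v) (cmLocalForm L 2 v))) ∈ cmLocalIntegralLevel L 2 (Matrix.of fun i j : Fin 2 => if i.val + j.val + 1 = 2 then (1 : L) else 0) v ∧ ((redMat ((((n : ↥(unitaryGroupOfForm (conjLocal L (IsCMField.complexConj L) v) (cmLocalForm L 2 v))) : GL (Fin 2) (LocalRing L v)).val.map (Pi.evalRingHom (fun w' : PlacesOver L v => w'.1.adicCompletion L) w))) - 1) ^ 2 = 0 ∧ (redMat ((((n : ↥(unitaryGroupOfForm (conjLocal L (IsCMField.complexConj L) v) (cmLocalForm L 2 v))) : GL (Fin 2) (LocalRing L v)).val.map (Pi.evalRingHom (fun w' : PlacesOver L v => w'.1.adicCompletion L) w))) - 1).rank = 1)}) := by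
    have hS : ({n : ↥(cmBorelTriple L 2 v).N | (n : ↥(unitaryGroupOfForm (conjLocal L (IsCMField.complexConj L) v) (cmLocalForm L 2 v))) ∈ cmLocalIntegralLevel L 2 (Matrix.of fun i j : Fin 2 => if i.val + j.val + 1 = 2 then (1 : L) else 0) v ∧ ((redMat ((((n : ↥(unitaryGroupOfForm (conjLocal L (IsCMField.complexConj L) v) (cmLocalForm L 2 v))) : GL (Fin 2) (LocalRing L v)).val.map (Pi.evalRingHom (fun w' : PlacesOver L v => w'.1.adicCompletion L) w))) - 1) ^ 2 = 0 ∧ (redMat ((((n : ↥(unitaryGroupOfForm (conjLocal L (IsCMField.complexConj L) v) (cmLocalForm L 2 v))) : GL (Fin 2) (LocalRing L v)).val.map (Pi.evalRingHom (fun w' : PlacesOver L v => w'.1.adicCompletion L) w))) - 1).rank = 1)}) =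
        (fun n : ↥(cmBorelTriple L 2 v).N => (((((n : ↥(unitaryGroupOfForm (conjLocal L (IsCMField.complexConj L) v) (cmLocalForm L 2 v))) : GL (Fin 2) (LocalRing L v)) : Matrix (Fin 2) (Fin 2) (LocalRing L v)) 0 1) w)) ⁻¹'
          ({z : w.1.adicCompletion L | Valued.v z ≤ 1} \ {z : w.1.adicCompletion L | Valued.v z < 1}) := by
      ext n
      simp only [Set.mem_setOf_eq, Set.mem_preimage, Set.mem_sdiff, not_lt]
      rw [unipotent_mem_cmLocalIntegralLevel_iff L v w hw, rank_redMat_unipotent_sub_one_eq_one_iff]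
      constructor
      · rintro ⟨hle, -, h1⟩
        exact ⟨hle, h1.ge⟩
      · rintro ⟨hle, hge⟩
        exact ⟨hle, sq_redMat_unipotent_sub_one L v w n, le_antisymm hle hge⟩
    have hcl : IsClosed {z : w.1.adicCompletion L | Valued.v z ≤ 1} := by
      have h : {z : w.1.adicCompletion L | Valued.v z ≤ 1} = ((Valued.v : Valuation (w.1.adicCompletion L) _).integer : Set (w.1.adicCompletion L)) := by
        ext z
        rw [Set.mem_setOf_eq, SetLike.mem_coe, Valuation.mem_integer_iff]
      rw [h]
      exact Valued.isClosed_integer (w.1.adicCompletion L)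
    rw [hS]
    exact ((hcl.sdiff (isOpen_setOf_valued_lt_one L v w)).preimage hcont).measurableSet
  -- evaluate the Iwasawa integral: `κ₂(K₂) · μ(S_s)`
  rw [hint, integral_fun_snd, integral_indicator_const (1 : ℂ) hSmeas, measureReal_lineStratum_one_of_ramified L v w hw μN₂ he h2w, zero_smul, smul_zero, smul_zero]
end Literature.NumberTheory.Automorphic.UnitaryGroup

end
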